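import Mathlib
import HarnessLib
import Literature.Computability.AlgebraicComplexity.BDI20ColouringGadgets
import Literature.Computability.AlgebraicComplexity.BDI20GridLikeLayeredGraphs

/-!
# BDI20 §8, Lemma 29 (= Lemma 26, second half): the `8`-regular gadget graph of a grid subgraph with
# equality / inequality edges — COMBINATORIAL LAYER (vertex set, multiplicities, degrees, colourings)

M. Bläser, J. Dörfler, C. Ikenmeyer, *On the complexity of evaluating highest weight vectors*,
arXiv:2002.11594 (= CCC 2021, LIPIcs 200:29), §8. TeX of record `HOME/lit/src/2002.11594/fullversion.tex`
(sha16 9e732dfe87cd0d83): Lemma 26 `lem:gridlikehardnessregular` proof L1917–1932 (the replacement of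
every edge by a gadget, "Clearly `G` is now properly `3`-colorable iff `G_2` is", "all those gadgets are
designed as grid-like layered graphs", "make the graph `8`-regular by adding copies of existing edges …
multigraph versions of `H^=_1, H^=_2, H^≠_1` and `H^≠_2` exist which are `8`-regular except for the
vertices `v_1` and `v_2`, which can independently have a degree of `2, 4, 6` or `8` each") and Lemma 29
`lem:gridlikeethhardness` L2272–2283 ("We reduce from relational `3`-coloring on subgraphs of grids …
each equality edge is replaced by the corresponding equality gadget and each inequality edge is replaced
by the corresponding inequality gadget. Note that the obtained graph `G_2` now has `O(|V(G)|)` many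
vertices. If we can decide whether the `8`-regular grid-like layered graph `G_2` allows for a proper
`3`-coloring … we can decide via this reduction whether `G` allows for a relational `3`-coloring").
Numbering: arXiv flat (CCC 2021 in brackets): Def. 24 [8.3], Lemma 26 [8.5], Lemma 28 [8.7], Lemma 29
[8.8]. Cell val-lit, typer t20 g10; FILE D (part 1, the COMBINATORIAL layer) of the §8 programme
(`HOME/np/MEMO-t21g11-BDI20-sec8-gadgets.md`, lead-np RULING (124), closer-owner x6 g8's
`HOME/np/NOTE-x6g8-BDI20-sec8-LAYOUT.md`: "`regularise : RelGridGraph N′ (no isolated vertex) ↦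
GridLikeLayered n″`, `IsRegular 8`, `n″ ≤ c·N′`, colourable iff, vertex type `Fin n″` with `n″` a closed
form, `pos`/`mult` closed-form defs"). Inputs in the tree: FILE A `BDI20GridLikeLayeredGraphs.lean`
(`RelGridGraph`, `IsProperRel`, `IsRelColourable`, `GridAdjacent`), FILE B `BDI20ColouringGadgets.lean`
(the four gadgets, their `8`-regular multigraph versions `…Mult a b` and the proved facts
`…_proper_iff`, `…Mult_pos_iff`, `…Mult_degree`, `…Mult_symm`). HONEST FRAMING: bookkeeping of an NP- and
ETH-hardness reduction about EVALUATING highest weight vectors; nothing here bears on `VP` versus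
`VNP`, which is NOT proved.

## What the source prints and how it is rendered (this file = everything EXCEPT the geometry)

* **The replaced graph `G₂` of `H : RelGridGraph N`** (L1917–1919, L2278–2280): its vertices are the
  `N` old vertices (the ports) and the inner vertices of one gadget per edge — `5` for an equality
  gadget (`H^=_1` horizontal / `H^=_2` vertical), `6` for an inequality gadget; = the structured type
  `W = Fin N ⊕ (Fin numEq × Fin 5 ⊕ Fin numNe × Fin 6)` with the edge lists `eqList` / `neList` (each
  edge once, smaller vertex first, `mem_eqList_iff`), the gadget index `GIdx = Fin numEq ⊕ Fin numNe`,
  `edgeOf`, the geometric lower/upper end `lo` / `hi` of an edge and `isHor` (variant `1` or `2`), the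
  attachment maps `attachEq`/`attachNe` (local vertex `0` ↦ lower end, last ↦ upper end, the others ↦
  the new inner vertices) with their partial inverses `idxEq`/`idxNe`; the CLOSED-FORM vertex count
  ★ `card₂ = N + (5·numEq + 6·numNe)` with the explicit arithmetic bijection `wEquiv : Fin card₂ ≃ W`,
  and ★ `card₂_le : card₂ ≤ 13·N` ("`O(|V(G)|)` many vertices"; handshake `numEq_add_numNe_le`).
* **The multiplicities** (L1927–1932): port parameters by the allocation `(4)`, `(2,2)`, `(2,1,1)`,
  `(1,1,1,1)` of the half-degree `4` among the `d ∈ {1,…,4}` gadgets at a port (`incCount`, `rank`,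
  `shareTable`, `share`; the print only says the port degrees "can independently" be `2, 4, 6, 8`),
  the per-gadget tables `multEq`/`multNe` = FILE B's `…Mult` with these parameters (vertical variants:
  the print's `a` at the TOP vertex), and the CLOSED-FORM ★ `mult : W → W → ℕ` (no choice: the unique
  gadget containing both vertices, read through `idxEq`/`idxNe`; two ports are never adjacent inside a
  gadget) with `mult_attachEq/Ne` (it IS the gadget table), `exists_attach_of_mult_pos`,
  `multEq_pos_iff` (support = the simple gadget), `mult_comm`, `mult_self`; on `Fin card₂`: `mult₂`.
* **"`8`-regular"** (L1927–1932, L2281): ★ `degW_eq_eight` — every vertex of `G₂` has degree `8`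
  with multiplicity, under `NoIsolated` (every vertex of `H` on an edge — x6's crossbar instances have
  this; it is also forced by Def. 24 (6)) and `EdgesSimple` (no edge carries both labels); inner
  vertices by FILE B's `…Mult_degree`, ports by `degW_port_eq` + ★ `sum_share_eq_four` (the allocation)
  with `one_le_incCount` / `incCount_le_four` (a grid point has four neighbours; `edgeOf_injective`);
  on `Fin card₂`: ★ `sum_mult₂_eq_eight`.
* **"`G` allows for a relational `3`-coloring" iff "`G_2` allows for a proper `3`-coloring"** (L1921,
  L2282–2283): ★ `exists_isProperW_iff : (∃ c, IsProperW c) ↔ H.IsRelColourable` (→ each gadget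
  restricts to a proper colouring with its port colours, so FILE B's specifications `specEq`/`specNe`
  give the relations, `isProperRel_iff_gadgets`; ← glue one witness colouring per gadget — distinct
  gadgets share only ports); on `Fin card₂`: ★ `exists_proper_mult₂_iff`. (The same logical principle
  in abstract form is `BDI20GadgetAssembly.lean`; here it is re-proved on the closed-form `mult` the
  code-level reduction needs.)
* **The embedding** `e : V(G₂) → ℕ × ℕ` (Def. 24, L1925–1926 "replacing all edges in a subgraph of a
  grid yields a grid-like layered graph"): DEFINED in closed form — ports at `4·e_H + (2,2)`, inner
  vertices by the PARITY MIRRORING rule `place` (horizontal gadgets keep their bumps above the axis at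
  even lower ends and below at odd ones, vertical gadgets left at even / right at odd; registry B47:
  as drawn, the placement collides at every vertex with a rightward and an upward edge) = `posW`,
  `pos₂`. The PROOFS that `(pos₂, mult₂)` satisfy Def. 24 (injective, consecutive layers, horizontal
  neighbours, non-crossing, every vertex on an inter-layer edge) — i.e. the `GridLikeLayered card₂`
  packaging and FILE A's Lemma 25 downstream — are the GEOMETRIC half (FILE D part 2,
  `HOME/np/MEMO-t20g10-BDI20-FILE-D-blueprint.md` §3), NOT in this file.

Nothing in this file is a conjecture or a named fact; no `instance`, no notation; `Classical.choice`
only inside the proof of `exists_isProperW_iff` (one witness colouring per gadget), never in a `def`.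

## References
* [BlaserDorflerIkenmeyer2020] M. Bläser, J. Dörfler, C. Ikenmeyer, *On the complexity of evaluating
  highest weight vectors*, arXiv:2002.11594 / CCC 2021 — Lemma 26 proof (TeX L1917–1932), Lemma 29
  (L2272–2283), Def. 24 (L1665–1678).
-/

namespace Literature.Computability.AlgebraicComplexity

namespace BDI2020

open Gadgets

namespace RelGridGraph

variable {N : ℕ} (H : RelGridGraph N)

/-! ## The edges of `H` as lists; gadget indices -/

/-- All ordered pairs `(u, v)` of vertices with `u < v`, in a fixed order. [cite: BlaserDorflerIkenmeyer2020, Lemma 29, proof ("each equality edge is replaced …") (arXiv, TeX L2278–2280; = CCC 2021 Lemma 8.8)] -/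
def pairList (N : ℕ) : List (Fin N × Fin N) :=
  ((List.finRange N).flatMap fun u => (List.finRange N).map fun v => (u, v)).filter
    fun p => decide (p.1 < p.2)

/-- The equality edges of `H`, each once (`u < v`). [cite: BlaserDorflerIkenmeyer2020, Lemma 29, proof (arXiv, TeX L2278–2280; = CCC 2021 Lemma 8.8)] -/
def eqList : List (Fin N × Fin N) := (pairList N).filter fun p => H.eqAdj p.1 p.2

/-- The inequality edges of `H`, each once (`u < v`). [cite: BlaserDorflerIkenmeyer2020, Lemma 29, proof (arXiv, TeX L2278–2280; = CCC 2021 Lemma 8.8)] -/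
def neList : List (Fin N × Fin N) := (pairList N).filter fun p => H.neAdj p.1 p.2

/-- Number of equality edges. [cite: BlaserDorflerIkenmeyer2020, Lemma 29, proof (arXiv, TeX L2281 "`G_2` now has `O(|V(G)|)` many vertices"; = CCC 2021 Lemma 8.8)] -/
def numEq : ℕ := H.eqList.length

/-- Number of inequality edges. [cite: BlaserDorflerIkenmeyer2020, Lemma 29, proof (arXiv, TeX L2281; = CCC 2021 Lemma 8.8)] -/
def numNe : ℕ := H.neList.length

/-- Membership in the pair list. [cite: BlaserDorflerIkenmeyer2020, Lemma 29, proof (arXiv, TeX L2278–2280; = CCC 2021 Lemma 8.8)] -/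
theorem mem_pairList_iff {p : Fin N × Fin N} : p ∈ pairList N ↔ p.1 < p.2 := by
  obtain ⟨u, v⟩ := p
  simp [pairList, List.mem_filter, List.mem_flatMap, List.mem_map]

/-- Membership in the equality edge list. [cite: BlaserDorflerIkenmeyer2020, Lemma 29, proof (arXiv, TeX L2278–2280; = CCC 2021 Lemma 8.8)] -/
theorem mem_eqList_iff {p : Fin N × Fin N} : p ∈ H.eqList ↔ p.1 < p.2 ∧ H.eqAdj p.1 p.2 = true := by
  simp [eqList, List.mem_filter, mem_pairList_iff]

/-- Membership in the inequality edge list. [cite: BlaserDorflerIkenmeyer2020, Lemma 29, proof (arXiv, TeX L2278–2280; = CCC 2021 Lemma 8.8)] -/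
theorem mem_neList_iff {p : Fin N × Fin N} : p ∈ H.neList ↔ p.1 < p.2 ∧ H.neAdj p.1 p.2 = true := by
  simp [neList, List.mem_filter, mem_pairList_iff]

/-- The gadgets of `G₂`: one per equality edge (left summand) and one per inequality edge (right
summand), indexed by position in the edge lists. [cite: BlaserDorflerIkenmeyer2020, Lemma 29, proof (arXiv, TeX L2278–2280; = CCC 2021 Lemma 8.8)] -/
abbrev GIdx : Type := Fin H.numEq ⊕ Fin H.numNe

/-- The edge a gadget replaces. [cite: BlaserDorflerIkenmeyer2020, Lemma 29, proof (arXiv, TeX L2278–2280; = CCC 2021 Lemma 8.8)] -/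
def edgeOf : H.GIdx → Fin N × Fin N
  | Sum.inl j => H.eqList[j.1]'j.2
  | Sum.inr j => H.neList[j.1]'j.2

/-- Whether a gadget is an equality gadget. [cite: BlaserDorflerIkenmeyer2020, Lemma 29, proof (arXiv, TeX L2278–2280; = CCC 2021 Lemma 8.8)] -/
def isEqGadget : H.GIdx → Bool
  | Sum.inl _ => true
  | Sum.inr _ => false

/-- Gadget edges are listed with the smaller vertex first. [cite: BlaserDorflerIkenmeyer2020, Lemma 29, proof (arXiv, TeX L2278–2281; = CCC 2021 Lemma 8.8)] -/
theorem edgeOf_fst_lt_snd (g : H.GIdx) : (H.edgeOf g).1 < (H.edgeOf g).2 := by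
  cases g with
  | inl j => exact (H.mem_eqList_iff.1 (List.getElem_mem j.2)).1
  | inr j => exact (H.mem_neList_iff.1 (List.getElem_mem j.2)).1

/-- An equality gadget replaces an equality edge. [cite: BlaserDorflerIkenmeyer2020, Lemma 29, proof (arXiv, TeX L2278–2281; = CCC 2021 Lemma 8.8)] -/
theorem eqAdj_edgeOf (j : Fin H.numEq) : H.eqAdj (H.edgeOf (Sum.inl j)).1 (H.edgeOf (Sum.inl j)).2 = true :=
  (H.mem_eqList_iff.1 (List.getElem_mem j.2)).2

/-- An inequality gadget replaces an inequality edge. [cite: BlaserDorflerIkenmeyer2020, Lemma 29, proof (arXiv, TeX L2278–2281; = CCC 2021 Lemma 8.8)] -/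
theorem neAdj_edgeOf (j : Fin H.numNe) : H.neAdj (H.edgeOf (Sum.inr j)).1 (H.edgeOf (Sum.inr j)).2 = true :=
  (H.mem_neList_iff.1 (List.getElem_mem j.2)).2

/-! ## Geometry of an edge: which end is left/bottom, horizontal or vertical -/

/-- The geometric LOWER end of a gadget's edge (left end of a horizontal edge, bottom end of a
vertical one): the end with the smaller coordinate sum (grid neighbours differ by one in exactly one
coordinate). It plays `v₁` of `H^=_1`/`H^≠_1` and `v₂` (index `0`, the bottom vertex) of
`H^=_2`/`H^≠_2` — in all four gadgets the local vertex `0` at local position `(0,0)`.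
[cite: BlaserDorflerIkenmeyer2020, Lemma 26, Fig. eqneqgadget and proof ("If an edge is horizontal … variant 1 … vertical … variant 2") (arXiv, TeX L1919–1920; = CCC 2021 Lemma 8.5)] -/
def lo (g : H.GIdx) : Fin N :=
  if (H.pos (H.edgeOf g).1).1 + (H.pos (H.edgeOf g).1).2 ≤ (H.pos (H.edgeOf g).2).1 + (H.pos (H.edgeOf g).2).2
  then (H.edgeOf g).1 else (H.edgeOf g).2

/-- The geometric UPPER end (right / top) of a gadget's edge — the local vertex of largest index.
[cite: BlaserDorflerIkenmeyer2020, Lemma 26, Fig. eqneqgadget (arXiv, TeX L1919–1920; = CCC 2021 Lemma 8.5)] -/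
def hi (g : H.GIdx) : Fin N :=
  if (H.pos (H.edgeOf g).1).1 + (H.pos (H.edgeOf g).1).2 ≤ (H.pos (H.edgeOf g).2).1 + (H.pos (H.edgeOf g).2).2
  then (H.edgeOf g).2 else (H.edgeOf g).1

/-- An edge is horizontal when its ends lie in one row. [cite: BlaserDorflerIkenmeyer2020, Lemma 26, proof (arXiv, TeX L1919–1920; = CCC 2021 Lemma 8.5)] -/
def isHor (g : H.GIdx) : Bool := decide ((H.pos (H.edgeOf g).1).2 = (H.pos (H.edgeOf g).2).2)

/-- The two ends of a gadget's edge are distinct. [cite: BlaserDorflerIkenmeyer2020, Lemma 26, proof (arXiv, TeX L1917–1932; = CCC 2021 Lemma 8.5)] -/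
theorem lo_ne_hi (g : H.GIdx) : H.lo g ≠ H.hi g := by
  have h := H.edgeOf_fst_lt_snd g
  unfold lo hi
  split_ifs
  · exact h.ne
  · exact h.ne'

/-- The ends of a gadget's edge are its lower and upper end, in some order. [cite: BlaserDorflerIkenmeyer2020, Lemma 26, proof (arXiv, TeX L1917–1932; = CCC 2021 Lemma 8.5)] -/
theorem edgeOf_eq_lo_hi (g : H.GIdx) :
    (H.edgeOf g = (H.lo g, H.hi g)) ∨ (H.edgeOf g = (H.hi g, H.lo g)) := by
  unfold lo hi
  split_ifs
  · exact Or.inl rfl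
  · exact Or.inr rfl

/-! ## The vertices of `G₂` and the attachment of the gadgets -/

/-- **The vertices of `G₂`** in structured form: the `N` old vertices (ports), five inner vertices per
equality gadget (local indices `1..5` of `H^=_1`/`H^=_2`) and six per inequality gadget (local indices
`1..6` of `H^≠_1`/`H^≠_2`). [cite: BlaserDorflerIkenmeyer2020, Lemma 26, proof ("we construct a new graph `G_2` by replacing each edge …") (arXiv, TeX L1917–1919) and Lemma 29, proof (L2278–2281) (= CCC 2021 Lemmas 8.5, 8.8)] -/
abbrev W : Type := Fin N ⊕ ((Fin H.numEq × Fin 5) ⊕ (Fin H.numNe × Fin 6))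

/-- **The number of vertices of `G₂`**, a closed form in the data of `H`: `N + 5·#eq + 6·#ne`.
[cite: BlaserDorflerIkenmeyer2020, Lemma 29, proof ("`G_2` now has `O(|V(G)|)` many vertices") (arXiv, TeX L2281; = CCC 2021 Lemma 8.8)] -/
def card₂ : ℕ := N + (H.numEq * 5 + H.numNe * 6)

/-- The structured vertices as `Fin card₂` (explicit arithmetic bijection: ports first, then the
equality gadgets' inner vertices block by block, then the inequality gadgets').
[cite: BlaserDorflerIkenmeyer2020, Lemma 29, proof (arXiv, TeX L2281; = CCC 2021 Lemma 8.8)] -/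
def wEquiv : Fin H.card₂ ≃ H.W :=
  finSumFinEquiv.symm.trans
    (Equiv.sumCongr (Equiv.refl _)
      (finSumFinEquiv.symm.trans (Equiv.sumCongr finProdFinEquiv.symm finProdFinEquiv.symm)))

/-- The simple edges of the equality gadget `j` (variant by the edge's direction).
[cite: BlaserDorflerIkenmeyer2020, Lemma 26, proof and Fig. eqneqgadget (arXiv, TeX L1917–1920; = CCC 2021 Lemma 8.5)] -/
def edgesEq (j : Fin H.numEq) : List (Fin 7 × Fin 7) :=
  if H.isHor (Sum.inl j) then eqGadgetH.edges else eqGadgetV.edges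

/-- The simple edges of the inequality gadget `j`. [cite: BlaserDorflerIkenmeyer2020, Lemma 26, proof and Fig. eqneqgadget (arXiv, TeX L1917–1920; = CCC 2021 Lemma 8.5)] -/
def edgesNe (j : Fin H.numNe) : List (Fin 8 × Fin 8) :=
  if H.isHor (Sum.inr j) then neGadgetH.edges else neGadgetV.edges

/-- Attachment of the equality gadget `j`: local `0 ↦` lower end, `6 ↦` upper end, `1..5 ↦` its
inner vertices. [cite: BlaserDorflerIkenmeyer2020, Lemma 26, proof (arXiv, TeX L1917–1919; = CCC 2021 Lemma 8.5)] -/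
def attachEq (j : Fin H.numEq) (i : Fin 7) : H.W :=
  if i.1 = 0 then Sum.inl (H.lo (Sum.inl j))
  else if h : i.1 = 6 then Sum.inl (H.hi (Sum.inl j))
  else Sum.inr (Sum.inl (j, ⟨i.1 - 1, by omega⟩))

/-- Attachment of the inequality gadget `j`: local `0 ↦` lower end, `7 ↦` upper end, `1..6 ↦` inner.
[cite: BlaserDorflerIkenmeyer2020, Lemma 26, proof (arXiv, TeX L1917–1919; = CCC 2021 Lemma 8.5)] -/
def attachNe (j : Fin H.numNe) (i : Fin 8) : H.W :=
  if i.1 = 0 then Sum.inl (H.lo (Sum.inr j))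
  else if h : i.1 = 7 then Sum.inl (H.hi (Sum.inr j))
  else Sum.inr (Sum.inr (j, ⟨i.1 - 1, by omega⟩))

/-- The local index of a vertex in the equality gadget `j`, if it belongs to it.
[cite: BlaserDorflerIkenmeyer2020, Lemma 26, proof (arXiv, TeX L1917–1919; = CCC 2021 Lemma 8.5)] -/
def idxEq (j : Fin H.numEq) : H.W → Option (Fin 7)
  | Sum.inl v => if v = H.lo (Sum.inl j) then some 0 else if v = H.hi (Sum.inl j) then some 6 else none
  | Sum.inr (Sum.inl (j', i)) => if j' = j then some ⟨i.1 + 1, by omega⟩ else none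
  | Sum.inr (Sum.inr _) => none

/-- The local index of a vertex in the inequality gadget `j`, if it belongs to it.
[cite: BlaserDorflerIkenmeyer2020, Lemma 26, proof (arXiv, TeX L1917–1919; = CCC 2021 Lemma 8.5)] -/
def idxNe (j : Fin H.numNe) : H.W → Option (Fin 8)
  | Sum.inl v => if v = H.lo (Sum.inr j) then some 0 else if v = H.hi (Sum.inr j) then some 7 else none
  | Sum.inr (Sum.inl _) => none
  | Sum.inr (Sum.inr (j', i)) => if j' = j then some ⟨i.1 + 1, by omega⟩ else none

/-- Local index of an attached vertex (equality gadgets). [cite: BlaserDorflerIkenmeyer2020, Lemma 26, proof (arXiv, TeX L1917–1932; = CCC 2021 Lemma 8.5)] -/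
theorem idxEq_attachEq (j : Fin H.numEq) (i : Fin 7) : H.idxEq j (H.attachEq j i) = some i := by
  have hlh := (H.lo_ne_hi (Sum.inl j)).symm
  fin_cases i <;> simp [attachEq, idxEq, hlh]

/-- Local index of an attached vertex (inequality gadgets). [cite: BlaserDorflerIkenmeyer2020, Lemma 26, proof (arXiv, TeX L1917–1932; = CCC 2021 Lemma 8.5)] -/
theorem idxNe_attachNe (j : Fin H.numNe) (i : Fin 8) : H.idxNe j (H.attachNe j i) = some i := by
  have hlh := (H.lo_ne_hi (Sum.inr j)).symm
  fin_cases i <;> simp [attachNe, idxNe, hlh]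

/-- A vertex with a local index in an equality gadget is the attached vertex. [cite: BlaserDorflerIkenmeyer2020, Lemma 26, proof (arXiv, TeX L1917–1932; = CCC 2021 Lemma 8.5)] -/
theorem eq_attachEq_of_idxEq {j : Fin H.numEq} {w : H.W} {i : Fin 7} (h : H.idxEq j w = some i) :
    w = H.attachEq j i := by
  rcases w with v | ⟨⟨j', i'⟩⟩ | ⟨⟨j', i'⟩⟩
  · simp only [idxEq] at h
    split_ifs at h with h1 h2
    · obtain rfl := Option.some.inj h
      simp [attachEq, h1]
    · obtain rfl := Option.some.inj h
      simp [attachEq, h2]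
  · simp only [idxEq] at h
    split_ifs at h with h1
    obtain rfl := Option.some.inj h
    subst h1
    have hi' := i'.2
    simp only [attachEq, Nat.add_eq_zero_iff, one_ne_zero, and_false, ↓reduceIte, Nat.add_sub_cancel]
    rw [dif_neg (by omega)]
  · simp [idxEq] at h

/-- A vertex with a local index in an inequality gadget is the attached vertex. [cite: BlaserDorflerIkenmeyer2020, Lemma 26, proof (arXiv, TeX L1917–1932; = CCC 2021 Lemma 8.5)] -/
theorem eq_attachNe_of_idxNe {j : Fin H.numNe} {w : H.W} {i : Fin 8} (h : H.idxNe j w = some i) :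
    w = H.attachNe j i := by
  rcases w with v | ⟨⟨j', i'⟩⟩ | ⟨⟨j', i'⟩⟩
  · simp only [idxNe] at h
    split_ifs at h with h1 h2
    · obtain rfl := Option.some.inj h
      simp [attachNe, h1]
    · obtain rfl := Option.some.inj h
      simp [attachNe, h2]
  · simp [idxNe] at h
  · simp only [idxNe] at h
    split_ifs at h with h1
    obtain rfl := Option.some.inj h
    subst h1
    have hi' := i'.2
    simp only [attachNe, Nat.add_eq_zero_iff, one_ne_zero, and_false, ↓reduceIte, Nat.add_sub_cancel]
    rw [dif_neg (by omega)]

/-! ## Port multiplicities ("`v_1` and `v_2` … can independently have a degree of `2, 4, 6` or `8`") -/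

/-- `v` is an end of the edge of gadget `g`. [cite: BlaserDorflerIkenmeyer2020, Lemma 26, proof (arXiv, TeX L1917–1919; = CCC 2021 Lemma 8.5)] -/
abbrev MemG (g : H.GIdx) (v : Fin N) : Prop := v = H.lo g ∨ v = H.hi g

/-- A linear order on the gadgets (equality gadgets first). [cite: BlaserDorflerIkenmeyer2020, Lemma 29, proof (arXiv, TeX L2278–2280; = CCC 2021 Lemma 8.8)] -/
def gOrd : H.GIdx → ℕ
  | Sum.inl j => j.1
  | Sum.inr j => H.numEq + j.1

/-- The number of gadgets at the port `v` (= its degree in `H`). [cite: BlaserDorflerIkenmeyer2020, Lemma 26, proof (arXiv, TeX L1929–1932; = CCC 2021 Lemma 8.5)] -/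
def incCount (v : Fin N) : ℕ := (Finset.univ.filter fun g : H.GIdx => H.MemG g v).card

/-- The rank of gadget `g` among the gadgets at the port `v`. [cite: BlaserDorflerIkenmeyer2020, Lemma 26, proof (arXiv, TeX L1929–1932; = CCC 2021 Lemma 8.5)] -/
def rank (g : H.GIdx) (v : Fin N) : ℕ :=
  (Finset.univ.filter fun g' : H.GIdx => H.MemG g' v ∧ H.gOrd g' < H.gOrd g).card

/-- The allocation of the half-degree `4` of a port among its `d` gadgets: `(4)`, `(2,2)`, `(2,1,1)`,
`(1,1,1,1)` for `d = 1, 2, 3, 4` (so that the port degree `Σ 2a` is `8`; "`2a = deg(v_1)`").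
[cite: BlaserDorflerIkenmeyer2020, Lemma 26, proof and Fig. eqgadgetmult (arXiv, TeX L1929–1932, L2003–2006; = CCC 2021 Lemma 8.5)] -/
def shareTable (d r : ℕ) : ℕ :=
  if d ≤ 1 then 4 else if d = 2 then 2 else if d = 3 then (if r = 0 then 2 else 1) else 1

/-- The port multiplicity parameter `a` (resp. `b`) of gadget `g` at its end `v`.
[cite: BlaserDorflerIkenmeyer2020, Lemma 26, proof (arXiv, TeX L1929–1932; = CCC 2021 Lemma 8.5)] -/
def share (g : H.GIdx) (v : Fin N) : ℕ := shareTable (H.incCount v) (H.rank g v)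

/-- Port parameters are at least `1` (degree `≥ 2`). [cite: BlaserDorflerIkenmeyer2020, Lemma 26, proof (arXiv, TeX L1917–1932; = CCC 2021 Lemma 8.5)] -/
theorem one_le_shareTable (d r : ℕ) : 1 ≤ shareTable d r := by
  unfold shareTable; split_ifs <;> omega

/-- Port parameters are at most `4` (degree `≤ 8`). [cite: BlaserDorflerIkenmeyer2020, Lemma 26, proof (arXiv, TeX L1917–1932; = CCC 2021 Lemma 8.5)] -/
theorem shareTable_le (d r : ℕ) : shareTable d r ≤ 4 := by
  unfold shareTable; split_ifs <;> omega

/-- Port parameters are at least `1`. [cite: BlaserDorflerIkenmeyer2020, Lemma 26, proof (arXiv, TeX L1917–1932; = CCC 2021 Lemma 8.5)] -/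
theorem one_le_share (g : H.GIdx) (v : Fin N) : 1 ≤ H.share g v := one_le_shareTable _ _

/-- Port parameters are at most `4`. [cite: BlaserDorflerIkenmeyer2020, Lemma 26, proof (arXiv, TeX L1917–1932; = CCC 2021 Lemma 8.5)] -/
theorem share_le (g : H.GIdx) (v : Fin N) : H.share g v ≤ 4 := shareTable_le _ _

/-! ## Multiplicities of `G₂` (closed form) -/

/-- The multiplicity table of the equality gadget `j` (FILE B's `8`-regular multigraph version with
this gadget's port parameters; variant by direction; for the vertical variant the print's `a` sits
at the top port, local index `6`). [cite: BlaserDorflerIkenmeyer2020, Lemma 26, Fig. eqgadgetmult (arXiv, TeX L1935–2006; = CCC 2021 Lemma 8.5)] -/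
def multEq (j : Fin H.numEq) : Fin 7 → Fin 7 → ℕ :=
  if H.isHor (Sum.inl j) then
    eqGadgetHMult (H.share (Sum.inl j) (H.lo (Sum.inl j))) (H.share (Sum.inl j) (H.hi (Sum.inl j)))
  else
    eqGadgetVMult (H.share (Sum.inl j) (H.hi (Sum.inl j))) (H.share (Sum.inl j) (H.lo (Sum.inl j)))

/-- The multiplicity table of the inequality gadget `j`. [cite: BlaserDorflerIkenmeyer2020, Lemma 26, Fig. eqgadgetmult (arXiv, TeX L1935–2006; = CCC 2021 Lemma 8.5)] -/
def multNe (j : Fin H.numNe) : Fin 8 → Fin 8 → ℕ :=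
  if H.isHor (Sum.inr j) then
    neGadgetHMult (H.share (Sum.inr j) (H.lo (Sum.inr j))) (H.share (Sum.inr j) (H.hi (Sum.inr j)))
  else
    neGadgetVMult (H.share (Sum.inr j) (H.hi (Sum.inr j))) (H.share (Sum.inr j) (H.lo (Sum.inr j)))

/-- A multiplicity table read at two optional local indices (`0` if either is absent).
[cite: BlaserDorflerIkenmeyer2020, Lemma 26, proof (arXiv, TeX L1929–1932; = CCC 2021 Lemma 8.5)] -/
def optMult {k : ℕ} (M : Fin k → Fin k → ℕ) : Option (Fin k) → Option (Fin k) → ℕ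
  | some a, some b => M a b
  | _, _ => 0

/-- **The edge multiplicities of `G₂`** (closed form): two vertices are joined by as many edges as
the unique gadget containing both prescribes (two ports are never adjacent inside a gadget).
[cite: BlaserDorflerIkenmeyer2020, Lemma 26, proof ("by adding copies of existing edges … multigraph versions … `8`-regular except for the vertices `v_1` and `v_2`") (arXiv, TeX L1927–1932; = CCC 2021 Lemma 8.5)] -/
def mult : H.W → H.W → ℕ
  | Sum.inl _, Sum.inl _ => 0
  | Sum.inl u, Sum.inr (Sum.inl (j, i)) =>
      optMult (H.multEq j) (H.idxEq j (Sum.inl u)) (some ⟨i.1 + 1, by omega⟩)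
  | Sum.inl u, Sum.inr (Sum.inr (j, i)) =>
      optMult (H.multNe j) (H.idxNe j (Sum.inl u)) (some ⟨i.1 + 1, by omega⟩)
  | Sum.inr (Sum.inl (j, i)), w' => optMult (H.multEq j) (some ⟨i.1 + 1, by omega⟩) (H.idxEq j w')
  | Sum.inr (Sum.inr (j, i)), w' => optMult (H.multNe j) (some ⟨i.1 + 1, by omega⟩) (H.idxNe j w')

/-- Ports are not adjacent inside an equality gadget's multiplicity table (and the table has no loops
at the ports). [cite: BlaserDorflerIkenmeyer2020, Lemma 26, Fig. eqgadgetmult (arXiv; = CCC 2021 Lemma 8.5)] -/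
theorem multEq_ports (j : Fin H.numEq) :
    H.multEq j 0 6 = 0 ∧ H.multEq j 6 0 = 0 ∧ H.multEq j 0 0 = 0 ∧ H.multEq j 6 6 = 0 := by
  unfold multEq; split_ifs <;> simp [eqGadgetHMult, eqGadgetVMult, multOf]

/-- The same for inequality gadgets. [cite: BlaserDorflerIkenmeyer2020, Lemma 26, Fig. eqgadgetmult (arXiv; = CCC 2021 Lemma 8.5)] -/
theorem multNe_ports (j : Fin H.numNe) :
    H.multNe j 0 7 = 0 ∧ H.multNe j 7 0 = 0 ∧ H.multNe j 0 0 = 0 ∧ H.multNe j 7 7 = 0 := by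
  unfold multNe; split_ifs <;> simp [neGadgetHMult, neGadgetVMult, multOf]

/-- The multiplicity between two vertices of one equality gadget is read off its table.
[cite: BlaserDorflerIkenmeyer2020, Lemma 26, proof (arXiv, TeX L1927–1932; = CCC 2021 Lemma 8.5)] -/
theorem mult_attachEq (j : Fin H.numEq) (a b : Fin 7) :
    H.mult (H.attachEq j a) (H.attachEq j b) = H.multEq j a b := by
  obtain ⟨h06, h60, h00, h66⟩ := H.multEq_ports j
  have key : ∀ w w', w = H.attachEq j a → w' = H.attachEq j b → H.mult w w' = H.multEq j a b := by
    intro w w' hw hw'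
    have hidx := H.idxEq_attachEq j a
    rw [← hw] at hidx
    have hidx' := H.idxEq_attachEq j b
    rw [← hw'] at hidx'
    rcases w with u | ⟨⟨j', i'⟩⟩ | ⟨⟨j', i'⟩⟩
    · rcases w' with u' | ⟨⟨j'', i''⟩⟩ | ⟨⟨j'', i''⟩⟩
      · -- two ports
        have ha : a = 0 ∨ a = 6 := by
          simp only [idxEq] at hidx
          split_ifs at hidx <;> simp only [Option.some.injEq] at hidx
          · exact Or.inl hidx.symm
          · exact Or.inr hidx.symm
        have hb : b = 0 ∨ b = 6 := by
          simp only [idxEq] at hidx'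
          split_ifs at hidx' <;> simp only [Option.some.injEq] at hidx'
          · exact Or.inl hidx'.symm
          · exact Or.inr hidx'.symm
        simp only [mult]
        rcases ha with rfl | rfl <;> rcases hb with rfl | rfl <;> simp [h06, h60, h00, h66]
      · -- port, eq inner
        simp only [idxEq] at hidx'
        split_ifs at hidx' with hj
        rw [hj]
        simp only [mult, hidx, optMult]
        rw [Option.some.inj hidx']
      · -- port, ne inner: impossible
        simp [idxEq] at hidx'
    · -- eq inner first
      simp only [idxEq] at hidx
      split_ifs at hidx with hj
      rw [hj]
      simp only [mult, hidx', optMult]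
      rw [Option.some.inj hidx]
    · simp [idxEq] at hidx
  exact key _ _ rfl rfl

/-- The multiplicity between two vertices of one inequality gadget is read off its table.
[cite: BlaserDorflerIkenmeyer2020, Lemma 26, proof (arXiv, TeX L1927–1932; = CCC 2021 Lemma 8.5)] -/
theorem mult_attachNe (j : Fin H.numNe) (a b : Fin 8) :
    H.mult (H.attachNe j a) (H.attachNe j b) = H.multNe j a b := by
  obtain ⟨h07, h70, h00, h77⟩ := H.multNe_ports j
  have key : ∀ w w', w = H.attachNe j a → w' = H.attachNe j b → H.mult w w' = H.multNe j a b := by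
    intro w w' hw hw'
    have hidx := H.idxNe_attachNe j a
    rw [← hw] at hidx
    have hidx' := H.idxNe_attachNe j b
    rw [← hw'] at hidx'
    rcases w with u | ⟨⟨j', i'⟩⟩ | ⟨⟨j', i'⟩⟩
    · rcases w' with u' | ⟨⟨j'', i''⟩⟩ | ⟨⟨j'', i''⟩⟩
      · have ha : a = 0 ∨ a = 7 := by
          simp only [idxNe] at hidx
          split_ifs at hidx <;> simp only [Option.some.injEq] at hidx
          · exact Or.inl hidx.symm
          · exact Or.inr hidx.symm
        have hb : b = 0 ∨ b = 7 := by
          simp only [idxNe] at hidx'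
          split_ifs at hidx' <;> simp only [Option.some.injEq] at hidx'
          · exact Or.inl hidx'.symm
          · exact Or.inr hidx'.symm
        simp only [mult]
        rcases ha with rfl | rfl <;> rcases hb with rfl | rfl <;> simp [h07, h70, h00, h77]
      · simp [idxNe] at hidx'
      · simp only [idxNe] at hidx'
        split_ifs at hidx' with hj
        rw [hj]
        simp only [mult, hidx, optMult]
        rw [Option.some.inj hidx']
    · simp [idxNe] at hidx
    · simp only [idxNe] at hidx
      split_ifs at hidx with hj
      rw [hj]
      simp only [mult, hidx', optMult]
      rw [Option.some.inj hidx]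
  exact key _ _ rfl rfl

/-- **Support of the multiplicities, forward:** a positive multiplicity comes from one gadget.
[cite: BlaserDorflerIkenmeyer2020, Lemma 26, proof (arXiv, TeX L1927–1932; = CCC 2021 Lemma 8.5)] -/
theorem exists_attach_of_mult_pos {w w' : H.W} (h : 0 < H.mult w w') :
    (∃ j a b, w = H.attachEq j a ∧ w' = H.attachEq j b ∧ 0 < H.multEq j a b) ∨
      (∃ j a b, w = H.attachNe j a ∧ w' = H.attachNe j b ∧ 0 < H.multNe j a b) := by
  rcases w with u | ⟨⟨j, i⟩⟩ | ⟨⟨j, i⟩⟩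
  · rcases w' with u' | ⟨⟨j, i⟩⟩ | ⟨⟨j, i⟩⟩
    · simp [mult] at h
    · left
      simp only [mult] at h
      cases hq : H.idxEq j (Sum.inl u) with
      | none => rw [hq] at h; simp [optMult] at h
      | some a =>
        rw [hq] at h
        refine ⟨j, a, ⟨i.1 + 1, by omega⟩, H.eq_attachEq_of_idxEq hq, ?_, h⟩
        exact H.eq_attachEq_of_idxEq (by simp [idxEq])
    · right
      simp only [mult] at h
      cases hq : H.idxNe j (Sum.inl u) with
      | none => rw [hq] at h; simp [optMult] at h
      | some a =>
        rw [hq] at h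
        refine ⟨j, a, ⟨i.1 + 1, by omega⟩, H.eq_attachNe_of_idxNe hq, ?_, h⟩
        exact H.eq_attachNe_of_idxNe (by simp [idxNe])
  · left
    simp only [mult] at h
    cases hq : H.idxEq j w' with
    | none => rw [hq] at h; simp [optMult] at h
    | some b =>
      rw [hq] at h
      refine ⟨j, ⟨i.1 + 1, by omega⟩, b, ?_, H.eq_attachEq_of_idxEq hq, h⟩
      exact H.eq_attachEq_of_idxEq (by simp [idxEq])
  · right
    simp only [mult] at h
    cases hq : H.idxNe j w' with
    | none => rw [hq] at h; simp [optMult] at h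
    | some b =>
      rw [hq] at h
      refine ⟨j, ⟨i.1 + 1, by omega⟩, b, ?_, H.eq_attachNe_of_idxNe hq, h⟩
      exact H.eq_attachNe_of_idxNe (by simp [idxNe])

/-- Positive table entries are exactly the simple edges of the gadget (port parameters in `1..4`).
[cite: BlaserDorflerIkenmeyer2020, Lemma 26, Fig. eqgadgetmult (arXiv; = CCC 2021 Lemma 8.5)] -/
theorem multEq_pos_iff (j : Fin H.numEq) (a b : Fin 7) :
    0 < H.multEq j a b ↔ (a, b) ∈ H.edgesEq j ∨ (b, a) ∈ H.edgesEq j := by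
  have h1 := H.one_le_share (Sum.inl j) (H.lo (Sum.inl j))
  have h2 := H.share_le (Sum.inl j) (H.lo (Sum.inl j))
  have h3 := H.one_le_share (Sum.inl j) (H.hi (Sum.inl j))
  have h4 := H.share_le (Sum.inl j) (H.hi (Sum.inl j))
  unfold multEq edgesEq
  split_ifs
  · exact eqGadgetHMult_pos_iff h1 h2 h3 h4 a b
  · exact eqGadgetVMult_pos_iff h3 h4 h1 h2 a b

/-- The same for inequality gadgets. [cite: BlaserDorflerIkenmeyer2020, Lemma 26, Fig. eqgadgetmult (arXiv; = CCC 2021 Lemma 8.5)] -/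
theorem multNe_pos_iff (j : Fin H.numNe) (a b : Fin 8) :
    0 < H.multNe j a b ↔ (a, b) ∈ H.edgesNe j ∨ (b, a) ∈ H.edgesNe j := by
  have h1 := H.one_le_share (Sum.inr j) (H.lo (Sum.inr j))
  have h2 := H.share_le (Sum.inr j) (H.lo (Sum.inr j))
  have h3 := H.one_le_share (Sum.inr j) (H.hi (Sum.inr j))
  have h4 := H.share_le (Sum.inr j) (H.hi (Sum.inr j))
  unfold multNe edgesNe
  split_ifs
  · exact neGadgetHMult_pos_iff h1 h2 h3 h4 a b
  · exact neGadgetVMult_pos_iff h3 h4 h1 h2 a b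

/-! ## `G₂` is properly `3`-colourable iff `H` is relationally `3`-colourable (Lemma 29, logical half) -/

/-- A proper `3`-colouring of the multigraph `G₂` (multiplicities are irrelevant: support only).
[cite: BlaserDorflerIkenmeyer2020, Lemma 29, statement ("`3`-coloring … for `8`-regular grid-like layered graphs") (arXiv, TeX L2272–2275; = CCC 2021 Lemma 8.8)] -/
def IsProperW (c : H.W → Fin 3) : Prop := ∀ w w', 0 < H.mult w w' → c w ≠ c w'

/-- Local vertex `0` of an equality gadget is its lower end. [cite: BlaserDorflerIkenmeyer2020, Lemma 26, proof (arXiv, TeX L1917–1932; = CCC 2021 Lemma 8.5)] -/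
@[simp] theorem attachEq_zero (j : Fin H.numEq) : H.attachEq j 0 = Sum.inl (H.lo (Sum.inl j)) := by
  simp [attachEq]

/-- Local vertex `6` of an equality gadget is its upper end. [cite: BlaserDorflerIkenmeyer2020, Lemma 26, proof (arXiv, TeX L1917–1932; = CCC 2021 Lemma 8.5)] -/
@[simp] theorem attachEq_six (j : Fin H.numEq) : H.attachEq j 6 = Sum.inl (H.hi (Sum.inl j)) := by
  simp [attachEq]

/-- Local vertex `0` of an inequality gadget is its lower end. [cite: BlaserDorflerIkenmeyer2020, Lemma 26, proof (arXiv, TeX L1917–1932; = CCC 2021 Lemma 8.5)] -/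
@[simp] theorem attachNe_zero (j : Fin H.numNe) : H.attachNe j 0 = Sum.inl (H.lo (Sum.inr j)) := by
  simp [attachNe]

/-- Local vertex `7` of an inequality gadget is its upper end. [cite: BlaserDorflerIkenmeyer2020, Lemma 26, proof (arXiv, TeX L1917–1932; = CCC 2021 Lemma 8.5)] -/
@[simp] theorem attachNe_seven (j : Fin H.numNe) : H.attachNe j 7 = Sum.inl (H.hi (Sum.inr j)) := by
  simp [attachNe]

/-- The specification of the equality gadget `j` with the lower end as the first port (FILE B's
`eqGadgetH_proper_iff` / `eqGadgetV_proper_iff`; for the vertical variant the print's `v₁` is the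
top vertex, immaterial for the symmetric relation `=`).
[cite: BlaserDorflerIkenmeyer2020, Lemma 26, proof ("the colors of `v_1` and `v_2` are the same for the equality gadgets") (arXiv, TeX L1923; = CCC 2021 Lemma 8.5)] -/
theorem specEq (j : Fin H.numEq) (x y : Fin 3) :
    (∃ c : Fin 7 → Fin 3, Proper3 (H.edgesEq j) c ∧ c 0 = x ∧ c 6 = y) ↔ x = y := by
  unfold edgesEq
  split_ifs
  · exact eqGadgetH_proper_iff x y
  · rw [show (∃ c : Fin 7 → Fin 3, Proper3 eqGadgetV.edges c ∧ c 0 = x ∧ c 6 = y) ↔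
        (∃ c : Fin 7 → Fin 3, Proper3 eqGadgetV.edges c ∧ c 6 = y ∧ c 0 = x) from
        exists_congr fun c => by tauto, eqGadgetV_proper_iff]
    exact eq_comm

/-- The specification of the inequality gadget `j` ("… and different for the inequality gadgets").
[cite: BlaserDorflerIkenmeyer2020, Lemma 26, proof (arXiv, TeX L1923; = CCC 2021 Lemma 8.5)] -/
theorem specNe (j : Fin H.numNe) (x y : Fin 3) :
    (∃ c : Fin 8 → Fin 3, Proper3 (H.edgesNe j) c ∧ c 0 = x ∧ c 7 = y) ↔ x ≠ y := by
  unfold edgesNe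
  split_ifs
  · exact neGadgetH_proper_iff x y
  · rw [show (∃ c : Fin 8 → Fin 3, Proper3 neGadgetV.edges c ∧ c 0 = x ∧ c 7 = y) ↔
        (∃ c : Fin 8 → Fin 3, Proper3 neGadgetV.edges c ∧ c 7 = y ∧ c 0 = x) from
        exists_congr fun c => by tauto, neGadgetV_proper_iff]
    exact ne_comm

/-- From a proper colouring of `G₂`: equality gadgets force equal port colours.
[cite: BlaserDorflerIkenmeyer2020, Lemma 26, proof (arXiv, TeX L1921–1923; = CCC 2021 Lemma 8.5)] -/
theorem colour_lo_eq_hi_of_isProperW {c : H.W → Fin 3} (hc : H.IsProperW c) (j : Fin H.numEq) :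
    c (Sum.inl (H.lo (Sum.inl j))) = c (Sum.inl (H.hi (Sum.inl j))) := by
  have h := (H.specEq j _ _).1 ⟨fun i => c (H.attachEq j i), fun e he => ?_, rfl, rfl⟩
  · simpa using h
  · exact hc _ _ ((H.mult_attachEq j e.1 e.2).symm ▸ (H.multEq_pos_iff j e.1 e.2).2 (Or.inl he))

/-- From a proper colouring of `G₂`: inequality gadgets force different port colours.
[cite: BlaserDorflerIkenmeyer2020, Lemma 26, proof (arXiv, TeX L1921–1923; = CCC 2021 Lemma 8.5)] -/
theorem colour_lo_ne_hi_of_isProperW {c : H.W → Fin 3} (hc : H.IsProperW c) (j : Fin H.numNe) :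
    c (Sum.inl (H.lo (Sum.inr j))) ≠ c (Sum.inl (H.hi (Sum.inr j))) := by
  have h := (H.specNe j _ _).1 ⟨fun i => c (H.attachNe j i), fun e he => ?_, rfl, rfl⟩
  · simpa using h
  · exact hc _ _ ((H.mult_attachNe j e.1 e.2).symm ▸ (H.multNe_pos_iff j e.1 e.2).2 (Or.inl he))

/-- The port relations of all gadgets are exactly a proper relational colouring of `H`.
[cite: BlaserDorflerIkenmeyer2020, §8 before Lemma 28 (arXiv, TeX L2078) and Lemma 29, proof (L2278–2283) (= CCC 2021 §8, Lemma 8.8)] -/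
theorem isProperRel_iff_gadgets (cH : Fin N → Fin 3) :
    H.IsProperRel cH ↔
      (∀ j : Fin H.numEq, cH (H.lo (Sum.inl j)) = cH (H.hi (Sum.inl j))) ∧
        ∀ j : Fin H.numNe, cH (H.lo (Sum.inr j)) ≠ cH (H.hi (Sum.inr j)) := by
  constructor
  · rintro ⟨hE, hN⟩
    constructor
    · intro j
      have hadj := H.eqAdj_edgeOf j
      rcases H.edgeOf_eq_lo_hi (Sum.inl j) with h | h <;> rw [h] at hadj
      · exact hE _ _ hadj
      · exact (hE _ _ hadj).symm
    · intro j
      have hadj := H.neAdj_edgeOf j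
      rcases H.edgeOf_eq_lo_hi (Sum.inr j) with h | h <;> rw [h] at hadj
      · exact hN _ _ hadj
      · exact (hN _ _ hadj).symm
  · rintro ⟨hq, hn⟩
    have keyE : ∀ u v : Fin N, u < v → H.eqAdj u v = true → cH u = cH v := by
      intro u v huv he
      obtain ⟨i, hi, hget⟩ := List.mem_iff_getElem.1 ((H.mem_eqList_iff (p := (u, v))).2 ⟨huv, he⟩)
      have hj := hq ⟨i, hi⟩
      have hed : H.edgeOf (Sum.inl ⟨i, hi⟩) = (u, v) := hget
      rcases H.edgeOf_eq_lo_hi (Sum.inl ⟨i, hi⟩) with h | h <;> rw [hed] at h <;>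
        obtain ⟨h1, h2⟩ := Prod.mk.inj h
      · rw [h1, h2]; exact hj
      · rw [h1, h2]; exact hj.symm
    have keyN : ∀ u v : Fin N, u < v → H.neAdj u v = true → cH u ≠ cH v := by
      intro u v huv hne
      obtain ⟨i, hi, hget⟩ := List.mem_iff_getElem.1 ((H.mem_neList_iff (p := (u, v))).2 ⟨huv, hne⟩)
      have hj := hn ⟨i, hi⟩
      have hed : H.edgeOf (Sum.inr ⟨i, hi⟩) = (u, v) := hget
      rcases H.edgeOf_eq_lo_hi (Sum.inr ⟨i, hi⟩) with h | h <;> rw [hed] at h <;>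
        obtain ⟨h1, h2⟩ := Prod.mk.inj h
      · rw [h1, h2]; exact hj
      · rw [h1, h2]; exact hj.symm
    constructor
    · intro u v he
      rcases lt_trichotomy u v with huv | rfl | hvu
      · exact keyE u v huv he
      · rfl
      · rw [H.eqAdj_comm] at he; exact (keyE v u hvu he).symm
    · intro u v hne
      rcases lt_trichotomy u v with huv | rfl | hvu
      · exact keyN u v huv hne
      · exact absurd hne (by simp [H.neAdj_self])
      · rw [H.neAdj_comm] at hne; exact (keyN v u hvu hne).symm

/-- **Lemma 29 (logical half): `G₂` is properly `3`-colourable iff `H` is relationally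
`3`-colourable.** (→: every gadget restricts to a proper colouring with the port colours, so the
gadget specifications give the relations; ←: glue one witness colouring per gadget — distinct gadgets
share only ports.) [cite: BlaserDorflerIkenmeyer2020, Lemma 26, proof ("Clearly `G` is now properly `3`-colorable iff `G_2` is properly `3`-colorable") (arXiv, TeX L1921) and Lemma 29, proof (L2278–2283) (= CCC 2021 Lemmas 8.5, 8.8)] -/
theorem exists_isProperW_iff : (∃ c : H.W → Fin 3, H.IsProperW c) ↔ H.IsRelColourable := by
  constructor
  · rintro ⟨c, hc⟩
    refine ⟨fun v => c (Sum.inl v), (H.isProperRel_iff_gadgets _).2 ⟨?_, ?_⟩⟩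
    · exact fun j => H.colour_lo_eq_hi_of_isProperW hc j
    · exact fun j => H.colour_lo_ne_hi_of_isProperW hc j
  · rintro ⟨cH, hcH⟩
    obtain ⟨hq, hn⟩ := (H.isProperRel_iff_gadgets cH).1 hcH
    choose wq hwq using fun j => (H.specEq j _ _).2 (hq j)
    choose wn hwn using fun j => (H.specNe j _ _).2 (hn j)
    let C : H.W → Fin 3 := fun w => match w with
      | Sum.inl v => cH v
      | Sum.inr (Sum.inl (j, i)) => wq j ⟨i.1 + 1, by omega⟩
      | Sum.inr (Sum.inr (j, i)) => wn j ⟨i.1 + 1, by omega⟩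
    have hCq : ∀ j (a : Fin 7), C (H.attachEq j a) = wq j a := by
      intro j a
      by_cases h0 : a = 0
      · subst h0; rw [attachEq_zero]; exact (hwq j).2.1.symm
      by_cases h6 : a = 6
      · subst h6; rw [attachEq_six]; exact (hwq j).2.2.symm
      have h0' : a.1 ≠ 0 := fun h => h0 (Fin.ext h)
      have h6' : a.1 ≠ 6 := fun h => h6 (Fin.ext h)
      simp only [attachEq, h0', ↓reduceIte, h6', ↓reduceDIte, C]
      congr 1
      exact Fin.ext (by simp only; omega)
    have hCn : ∀ j (a : Fin 8), C (H.attachNe j a) = wn j a := by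
      intro j a
      by_cases h0 : a = 0
      · subst h0; rw [attachNe_zero]; exact (hwn j).2.1.symm
      by_cases h7 : a = 7
      · subst h7; rw [attachNe_seven]; exact (hwn j).2.2.symm
      have h0' : a.1 ≠ 0 := fun h => h0 (Fin.ext h)
      have h7' : a.1 ≠ 7 := fun h => h7 (Fin.ext h)
      simp only [attachNe, h0', ↓reduceIte, h7', ↓reduceDIte, C]
      congr 1
      exact Fin.ext (by simp only; omega)
    refine ⟨C, fun w w' hm => ?_⟩
    rcases H.exists_attach_of_mult_pos hm with ⟨j, a, b, rfl, rfl, hab⟩ | ⟨j, a, b, rfl, rfl, hab⟩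
    · rw [hCq, hCq]
      rcases (H.multEq_pos_iff j a b).1 hab with he | he
      · exact (hwq j).1 _ he
      · exact ((hwq j).1 _ he).symm
    · rw [hCn, hCn]
      rcases (H.multNe_pos_iff j a b).1 hab with he | he
      · exact (hwn j).1 _ he
      · exact ((hwn j).1 _ he).symm

/-! ## Degrees: every vertex of `G₂` has degree `8` -/

/-- The degree of a vertex of `G₂`, edges counted with multiplicity.
[cite: BlaserDorflerIkenmeyer2020, Lemma 26, statement ("`8`-regular, i.e. each vertex has degree exactly `8`") (arXiv, TeX L1663, L1800–1804; = CCC 2021 §8, Lemma 8.5)] -/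
def degW (w : H.W) : ℕ := ∑ w', H.mult w w'

/-- Summing a function of the local index over all vertices of `G₂` = summing over the gadget.
[folklore] -/
private theorem sum_optIdx {k : ℕ} (att : Fin k → H.W) (idx : H.W → Option (Fin k))
    (hidx : ∀ l, idx (att l) = some l) (hinv : ∀ w l, idx w = some l → w = att l)
    (F : Option (Fin k) → ℕ) (hF : F none = 0) :
    (∑ w, F (idx w)) = ∑ l, F (some l) := by
  classical
  have hinj : Function.Injective att := fun a b h => by
    have := hidx a; rw [h, hidx b] at this; exact (Option.some.inj this).symm
  rw [← Finset.sum_subset (Finset.subset_univ (Finset.univ.image att))]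
  · rw [Finset.sum_image (fun a _ b _ h => hinj h)]
    exact Finset.sum_congr rfl fun l _ => by rw [hidx]
  · intro w _ hw
    cases h : idx w with
    | none => exact hF
    | some l => exact absurd (Finset.mem_image.2 ⟨l, Finset.mem_univ _, (hinv w l h).symm⟩) hw

/-- **Inner vertices of equality gadgets have degree `8`.**
[cite: BlaserDorflerIkenmeyer2020, Lemma 26, proof ("`8`-regular except for the vertices `v_1` and `v_2`") (arXiv, TeX L1929–1931; = CCC 2021 Lemma 8.5)] -/
theorem degW_innerEq (j : Fin H.numEq) (i : Fin 5) : H.degW (Sum.inr (Sum.inl (j, i))) = 8 := by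
  have hs1 := H.share_le (Sum.inl j) (H.lo (Sum.inl j))
  have hs2 := H.share_le (Sum.inl j) (H.hi (Sum.inl j))
  unfold degW
  have : (∑ w', H.mult (Sum.inr (Sum.inl (j, i))) w') =
      ∑ w', (fun o => optMult (H.multEq j) (some ⟨i.1 + 1, by omega⟩) o) (H.idxEq j w') := by
    rfl
  rw [this, H.sum_optIdx (H.attachEq j) (H.idxEq j) (H.idxEq_attachEq j)
    (fun w l h => H.eq_attachEq_of_idxEq h) _ rfl]
  simp only [optMult]
  have hdeg : ∀ u : Fin 7, u ≠ 0 → u ≠ 6 → mdegree (H.multEq j) u = 8 := by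
    unfold multEq; split_ifs
    · exact (eqGadgetHMult_degree (by omega) (by omega)).2.2
    · exact (eqGadgetVMult_degree (by omega) (by omega)).2.2
  have hi5 := i.2
  exact hdeg ⟨i.1 + 1, by omega⟩ (Fin.ne_of_val_ne (by simp))
    (Fin.ne_of_val_ne (by simp only [Fin.coe_ofNat_eq_mod]; omega))

/-- **Inner vertices of inequality gadgets have degree `8`.**
[cite: BlaserDorflerIkenmeyer2020, Lemma 26, proof (arXiv, TeX L1929–1931; = CCC 2021 Lemma 8.5)] -/
theorem degW_innerNe (j : Fin H.numNe) (i : Fin 6) : H.degW (Sum.inr (Sum.inr (j, i))) = 8 := by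
  have hs1 := H.share_le (Sum.inr j) (H.lo (Sum.inr j))
  have hs2 := H.share_le (Sum.inr j) (H.hi (Sum.inr j))
  unfold degW
  have : (∑ w', H.mult (Sum.inr (Sum.inr (j, i))) w') =
      ∑ w', (fun o => optMult (H.multNe j) (some ⟨i.1 + 1, by omega⟩) o) (H.idxNe j w') := by
    rfl
  rw [this, H.sum_optIdx (H.attachNe j) (H.idxNe j) (H.idxNe_attachNe j)
    (fun w l h => H.eq_attachNe_of_idxNe h) _ rfl]
  simp only [optMult]
  have hdeg : ∀ u : Fin 8, u ≠ 0 → u ≠ 7 → mdegree (H.multNe j) u = 8 := by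
    unfold multNe; split_ifs
    · exact (neGadgetHMult_degree (by omega) (by omega)).2.2
    · exact (neGadgetVMult_degree (by omega) (by omega)).2.2
  have hi5 := i.2
  exact hdeg ⟨i.1 + 1, by omega⟩ (Fin.ne_of_val_ne (by simp))
    (Fin.ne_of_val_ne (by simp only [Fin.coe_ofNat_eq_mod]; omega))

/-- Row sums of a `7 × 7` table without its two port columns. [folklore] -/
private theorem sum_inner_seven (M : Fin 7 → Fin 7 → ℕ) (p : Fin 7) (h0 : M p 0 = 0) (h6 : M p 6 = 0) :
    (∑ i : Fin 5, M p ⟨i.1 + 1, by omega⟩) = mdegree M p := by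
  unfold mdegree
  symm
  conv_lhs => rw [Fin.sum_univ_succ, Fin.sum_univ_castSucc]
  have : M p (Fin.last 5).succ = 0 := h6
  rw [h0, zero_add, this, add_zero]
  exact Finset.sum_congr rfl fun i _ => by congr 1

/-- Row sums of an `8 × 8` table without its two port columns. [folklore] -/
private theorem sum_inner_eight (M : Fin 8 → Fin 8 → ℕ) (p : Fin 8) (h0 : M p 0 = 0) (h7 : M p 7 = 0) :
    (∑ i : Fin 6, M p ⟨i.1 + 1, by omega⟩) = mdegree M p := by
  unfold mdegree
  symm
  conv_lhs => rw [Fin.sum_univ_succ, Fin.sum_univ_castSucc]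
  have : M p (Fin.last 6).succ = 0 := h7
  rw [h0, zero_add, this, add_zero]
  exact Finset.sum_congr rfl fun i _ => by congr 1

/-- The port rows of an equality gadget's table sum to twice the port parameters.
[cite: BlaserDorflerIkenmeyer2020, Lemma 26, Fig. eqgadgetmult ("`2a = deg(v_1)` and `2b = deg(v_2)`") (arXiv, TeX L2003–2006; = CCC 2021 Lemma 8.5)] -/
theorem mdegree_multEq_ports (j : Fin H.numEq) :
    mdegree (H.multEq j) 0 = 2 * H.share (Sum.inl j) (H.lo (Sum.inl j)) ∧
      mdegree (H.multEq j) 6 = 2 * H.share (Sum.inl j) (H.hi (Sum.inl j)) := by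
  have hs1 := H.share_le (Sum.inl j) (H.lo (Sum.inl j))
  have hs2 := H.share_le (Sum.inl j) (H.hi (Sum.inl j))
  unfold multEq; split_ifs
  · obtain ⟨h0, h6, -⟩ := eqGadgetHMult_degree (a := H.share (Sum.inl j) (H.lo (Sum.inl j)))
      (b := H.share (Sum.inl j) (H.hi (Sum.inl j))) (by omega) (by omega)
    exact ⟨h0, h6⟩
  · obtain ⟨h6, h0, -⟩ := eqGadgetVMult_degree (a := H.share (Sum.inl j) (H.hi (Sum.inl j)))
      (b := H.share (Sum.inl j) (H.lo (Sum.inl j))) (by omega) (by omega)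
    exact ⟨h0, h6⟩

/-- The port rows of an inequality gadget's table sum to twice the port parameters.
[cite: BlaserDorflerIkenmeyer2020, Lemma 26, Fig. eqgadgetmult (arXiv, TeX L2003–2006; = CCC 2021 Lemma 8.5)] -/
theorem mdegree_multNe_ports (j : Fin H.numNe) :
    mdegree (H.multNe j) 0 = 2 * H.share (Sum.inr j) (H.lo (Sum.inr j)) ∧
      mdegree (H.multNe j) 7 = 2 * H.share (Sum.inr j) (H.hi (Sum.inr j)) := by
  have hs1 := H.share_le (Sum.inr j) (H.lo (Sum.inr j))
  have hs2 := H.share_le (Sum.inr j) (H.hi (Sum.inr j))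
  unfold multNe; split_ifs
  · obtain ⟨h0, h7, -⟩ := neGadgetHMult_degree (a := H.share (Sum.inr j) (H.lo (Sum.inr j)))
      (b := H.share (Sum.inr j) (H.hi (Sum.inr j))) (by omega) (by omega)
    exact ⟨h0, h7⟩
  · obtain ⟨h7, h0, -⟩ := neGadgetVMult_degree (a := H.share (Sum.inr j) (H.hi (Sum.inr j)))
      (b := H.share (Sum.inr j) (H.lo (Sum.inr j))) (by omega) (by omega)
    exact ⟨h0, h7⟩

/-- The contribution of the equality gadget `j` to the degree of the port `v`: twice its port
parameter if `v` is one of its ends, nothing otherwise.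
[cite: BlaserDorflerIkenmeyer2020, Lemma 26, proof (arXiv, TeX L1929–1932; = CCC 2021 Lemma 8.5)] -/
theorem sum_mult_port_innerEq (v : Fin N) (j : Fin H.numEq) :
    (∑ i : Fin 5, H.mult (Sum.inl v) (Sum.inr (Sum.inl (j, i)))) =
      if H.MemG (Sum.inl j) v then 2 * H.share (Sum.inl j) v else 0 := by
  obtain ⟨h06, h60, h00, h66⟩ := H.multEq_ports j
  obtain ⟨hd0, hd6⟩ := H.mdegree_multEq_ports j
  have hlh := H.lo_ne_hi (Sum.inl j)
  simp only [mult]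
  by_cases hlo : v = H.lo (Sum.inl j)
  · subst hlo
    have hidx : H.idxEq j (Sum.inl (H.lo (Sum.inl j))) = some 0 := by simp [idxEq]
    simp only [hidx, optMult, MemG, true_or, ↓reduceIte]
    rw [sum_inner_seven _ 0 h00 h06, hd0]
  by_cases hhi : v = H.hi (Sum.inl j)
  · subst hhi
    have hidx : H.idxEq j (Sum.inl (H.hi (Sum.inl j))) = some 6 := by simp [idxEq, hlh.symm]
    simp only [hidx, optMult, MemG, or_true, ↓reduceIte]
    rw [sum_inner_seven _ 6 h60 h66, hd6]
  · have hidx : H.idxEq j (Sum.inl v) = none := by simp [idxEq, hlo, hhi]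
    simp [hidx, optMult, MemG, hlo, hhi]

/-- The contribution of the inequality gadget `j` to the degree of the port `v`.
[cite: BlaserDorflerIkenmeyer2020, Lemma 26, proof (arXiv, TeX L1929–1932; = CCC 2021 Lemma 8.5)] -/
theorem sum_mult_port_innerNe (v : Fin N) (j : Fin H.numNe) :
    (∑ i : Fin 6, H.mult (Sum.inl v) (Sum.inr (Sum.inr (j, i)))) =
      if H.MemG (Sum.inr j) v then 2 * H.share (Sum.inr j) v else 0 := by
  obtain ⟨h07, h70, h00, h77⟩ := H.multNe_ports j
  obtain ⟨hd0, hd7⟩ := H.mdegree_multNe_ports j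
  have hlh := H.lo_ne_hi (Sum.inr j)
  simp only [mult]
  by_cases hlo : v = H.lo (Sum.inr j)
  · subst hlo
    have hidx : H.idxNe j (Sum.inl (H.lo (Sum.inr j))) = some 0 := by simp [idxNe]
    simp only [hidx, optMult, MemG, true_or, ↓reduceIte]
    rw [sum_inner_eight _ 0 h00 h07, hd0]
  by_cases hhi : v = H.hi (Sum.inr j)
  · subst hhi
    have hidx : H.idxNe j (Sum.inl (H.hi (Sum.inr j))) = some 7 := by simp [idxNe, hlh.symm]
    simp only [hidx, optMult, MemG, or_true, ↓reduceIte]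
    rw [sum_inner_eight _ 7 h70 h77, hd7]
  · have hidx : H.idxNe j (Sum.inl v) = none := by simp [idxNe, hlo, hhi]
    simp [hidx, optMult, MemG, hlo, hhi]

/-- The degree of a port is twice the sum of its port parameters over its gadgets.
[cite: BlaserDorflerIkenmeyer2020, Lemma 26, proof ("`v_1` and `v_2` … can independently have a degree of `2, 4, 6` or `8` each") (arXiv, TeX L1929–1932; = CCC 2021 Lemma 8.5)] -/
theorem degW_port_eq (v : Fin N) :
    H.degW (Sum.inl v) = 2 * ∑ g ∈ Finset.univ.filter (fun g : H.GIdx => H.MemG g v), H.share g v := by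
  unfold degW
  rw [Fintype.sum_sum_type]
  have h0 : (∑ u : Fin N, H.mult (Sum.inl v) (Sum.inl u)) = 0 :=
    Finset.sum_eq_zero fun u _ => by simp [mult]
  rw [h0, zero_add, Fintype.sum_sum_type, Fintype.sum_prod_type, Fintype.sum_prod_type]
  simp_rw [sum_mult_port_innerEq, sum_mult_port_innerNe]
  rw [Finset.sum_filter, Finset.mul_sum, Fintype.sum_sum_type]
  congr 1 <;> exact Finset.sum_congr rfl fun j _ => by split_ifs <;> ring

/-! ### The port allocation sums to `4` when the port meets `1` to `4` gadgets -/

/-- The gadget order is injective. [cite: BlaserDorflerIkenmeyer2020, Lemma 29, proof (arXiv, TeX L2278–2281; = CCC 2021 Lemma 8.8)] -/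
theorem gOrd_injective : Function.Injective H.gOrd := by
  rintro (j | j) (j' | j') h <;> simp only [gOrd] at h
  · exact congrArg Sum.inl (Fin.ext h)
  · exact absurd h (by have := j.2; omega)
  · exact absurd h (by have := j'.2; omega)
  · exact congrArg Sum.inr (Fin.ext (by omega))

/-- `rank g v = 0` says no gadget at `v` precedes `g`. [folklore] -/
private theorem rank_eq_zero_iff (g : H.GIdx) (v : Fin N) :
    H.rank g v = 0 ↔ ∀ g' : H.GIdx, H.MemG g' v → ¬ H.gOrd g' < H.gOrd g := by
  unfold rank
  rw [Finset.card_eq_zero, Finset.filter_eq_empty_iff]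
  simp only [Finset.mem_univ, true_implies, not_and]

/-- **The allocation works:** the port parameters of the gadgets at a port of `H`-degree `1 ≤ d ≤ 4`
sum to `4` (`(4)`, `(2,2)`, `(2,1,1)`, `(1,1,1,1)`), so the port has degree `8`.
[cite: BlaserDorflerIkenmeyer2020, Lemma 26, proof ("the vertices `v_1` and `v_2`, which can independently have a degree of `2, 4, 6` or `8` each") (arXiv, TeX L1929–1932; = CCC 2021 Lemma 8.5)] -/
theorem sum_share_eq_four (v : Fin N) (h1 : 1 ≤ H.incCount v) (h4 : H.incCount v ≤ 4) :
    (∑ g ∈ Finset.univ.filter (fun g : H.GIdx => H.MemG g v), H.share g v) = 4 := by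
  set S := Finset.univ.filter (fun g : H.GIdx => H.MemG g v) with hS
  have hcard : S.card = H.incCount v := rfl
  have hmemS : ∀ g, g ∈ S ↔ H.MemG g v := fun g => by simp [hS]
  rcases (show H.incCount v = 1 ∨ H.incCount v = 2 ∨ H.incCount v = 3 ∨ H.incCount v = 4 by omega)
    with hd | hd | hd | hd
  · have : ∀ g ∈ S, H.share g v = 4 := fun g _ => by simp [share, shareTable, hd]
    rw [Finset.sum_congr rfl this, Finset.sum_const, hcard, hd]; rfl
  · have : ∀ g ∈ S, H.share g v = 2 := fun g _ => by simp [share, shareTable, hd]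
    rw [Finset.sum_congr rfl this, Finset.sum_const, hcard, hd]; rfl
  · -- `(2,1,1)`: exactly the first gadget gets `2`
    have hsh : ∀ g ∈ S, H.share g v = 1 + (if H.rank g v = 0 then 1 else 0) := fun g _ => by
      have : H.share g v = if H.rank g v = 0 then 2 else 1 := by simp [share, shareTable, hd]
      rw [this]; split_ifs <;> rfl
    rw [Finset.sum_congr rfl hsh, Finset.sum_add_distrib, Finset.sum_const, hcard, hd, smul_eq_mul,
      mul_one, Finset.sum_boole]
    suffices hone : (S.filter fun g => H.rank g v = 0).card = 1 by
      simp [hone]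
    have hne : S.Nonempty := Finset.card_pos.1 (by omega)
    obtain ⟨g₀, hg₀, hmin⟩ := Finset.exists_min_image S H.gOrd hne
    rw [Finset.card_eq_one]
    refine ⟨g₀, Finset.eq_singleton_iff_unique_mem.2 ⟨?_, ?_⟩⟩
    · rw [Finset.mem_filter, rank_eq_zero_iff]
      exact ⟨hg₀, fun g' hg' hlt => absurd (hmin g' ((hmemS g').2 hg')) (by omega)⟩
    · intro g hg
      rw [Finset.mem_filter, rank_eq_zero_iff] at hg
      have h₁ := hg.2 g₀ ((hmemS g₀).1 hg₀)
      have h₂ := hmin g hg.1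
      exact H.gOrd_injective (by omega)
  · have : ∀ g ∈ S, H.share g v = 1 := fun g _ => by simp [share, shareTable, hd]
    rw [Finset.sum_congr rfl this, Finset.sum_const, hcard, hd]; rfl

/-! ### The number of gadgets at a port: at least one (no isolated vertex), at most four (grid) -/

/-- The hypothesis "no isolated vertex" of Lemma 29's instances (every vertex of `H` lies on an
equality or inequality edge; needed for Def. 24 (6) and for the allocation).
[cite: BlaserDorflerIkenmeyer2020, Lemma 28, proof (the construction; every vertex lies on an edge) and Def. 24 (6) (arXiv, TeX L2090–2116, L1674; = CCC 2021 Lemma 8.7, Def. 8.3)] -/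
def NoIsolated (H : RelGridGraph N) : Prop := ∀ v : Fin N, ∃ u, H.eqAdj v u = true ∨ H.neAdj v u = true

/-- The hypothesis "no edge is both an equality and an inequality edge".
[cite: BlaserDorflerIkenmeyer2020, §8 before Lemma 28 ("every edge can either be an equality or inequality edge") (arXiv, TeX L2078; = CCC 2021 §8)] -/
def EdgesSimple (H : RelGridGraph N) : Prop := ∀ u v : Fin N, ¬ (H.eqAdj u v = true ∧ H.neAdj u v = true)

/-- Without isolated vertices every port meets a gadget. [cite: BlaserDorflerIkenmeyer2020, Lemma 26, proof (arXiv, TeX L1917–1932; = CCC 2021 Lemma 8.5)] -/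
theorem one_le_incCount (hiso : H.NoIsolated) (v : Fin N) : 1 ≤ H.incCount v := by
  obtain ⟨u, hu⟩ := hiso v
  have huv : u ≠ v := by
    rintro rfl
    rcases hu with h | h
    · simp [H.eqAdj_self] at h
    · simp [H.neAdj_self] at h
  unfold incCount
  apply Finset.card_pos.2
  -- the ordered pair and the gadget replacing it
  have key : ∀ a b : Fin N, a < b → (v = a ∨ v = b) →
      (H.eqAdj a b = true ∨ H.neAdj a b = true) →
      (Finset.univ.filter fun g : H.GIdx => H.MemG g v).Nonempty := by
    intro a b hab hv hadj
    rcases hadj with h | h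
    · obtain ⟨i, hi, hget⟩ := List.mem_iff_getElem.1 ((H.mem_eqList_iff (p := (a, b))).2 ⟨hab, h⟩)
      refine ⟨Sum.inl ⟨i, hi⟩, Finset.mem_filter.2 ⟨Finset.mem_univ _, ?_⟩⟩
      have hed : H.edgeOf (Sum.inl ⟨i, hi⟩) = (a, b) := hget
      rcases H.edgeOf_eq_lo_hi (Sum.inl ⟨i, hi⟩) with h' | h' <;> rw [hed] at h' <;>
        obtain ⟨h1, h2⟩ := Prod.mk.inj h' <;> unfold MemG
      · rcases hv with rfl | rfl
        · exact Or.inl h1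
        · exact Or.inr h2
      · rcases hv with rfl | rfl
        · exact Or.inr h1
        · exact Or.inl h2
    · obtain ⟨i, hi, hget⟩ := List.mem_iff_getElem.1 ((H.mem_neList_iff (p := (a, b))).2 ⟨hab, h⟩)
      refine ⟨Sum.inr ⟨i, hi⟩, Finset.mem_filter.2 ⟨Finset.mem_univ _, ?_⟩⟩
      have hed : H.edgeOf (Sum.inr ⟨i, hi⟩) = (a, b) := hget
      rcases H.edgeOf_eq_lo_hi (Sum.inr ⟨i, hi⟩) with h' | h' <;> rw [hed] at h' <;>
        obtain ⟨h1, h2⟩ := Prod.mk.inj h' <;> unfold MemG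
      · rcases hv with rfl | rfl
        · exact Or.inl h1
        · exact Or.inr h2
      · rcases hv with rfl | rfl
        · exact Or.inr h1
        · exact Or.inl h2
  rcases lt_or_gt_of_ne huv with h | h
  · refine key u v h (Or.inr rfl) ?_
    rcases hu with h' | h'
    · exact Or.inl (by rw [H.eqAdj_comm]; exact h')
    · exact Or.inr (by rw [H.neAdj_comm]; exact h')
  · exact key v u h (Or.inl rfl) hu

/-- The end of gadget `g` other than `v`. [cite: BlaserDorflerIkenmeyer2020, Lemma 26, proof (arXiv, TeX L1917–1919; = CCC 2021 Lemma 8.5)] -/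
def other (g : H.GIdx) (v : Fin N) : Fin N := if v = H.lo g then H.hi g else H.lo g

/-- The edge of a gadget at `v` is `{v, other}`. [cite: BlaserDorflerIkenmeyer2020, Lemma 26, proof (arXiv, TeX L1917–1932; = CCC 2021 Lemma 8.5)] -/
theorem edgeOf_eq_of_memG {g : H.GIdx} {v : Fin N} (h : H.MemG g v) :
    H.edgeOf g = (v, H.other g v) ∨ H.edgeOf g = (H.other g v, v) := by
  have hlh := H.lo_ne_hi g
  unfold other
  rcases h with rfl | rfl
  · simp only [↓reduceIte]
    exact H.edgeOf_eq_lo_hi g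
  · rw [if_neg hlh.symm]
    exact (H.edgeOf_eq_lo_hi g).symm

/-- The two ends of a gadget's edge are grid neighbours. [cite: BlaserDorflerIkenmeyer2020, §8 before Lemma 28 ("the graph is a subset of a grid graph") (arXiv, TeX L2078; = CCC 2021 §8)] -/
theorem gridAdjacent_other {g : H.GIdx} {v : Fin N} (h : H.MemG g v) :
    GridAdjacent (H.pos v) (H.pos (H.other g v)) := by
  have hadj : GridAdjacent (H.pos (H.edgeOf g).1) (H.pos (H.edgeOf g).2) := by
    rcases g with j | j
    · exact H.eqAdj_grid _ _ (H.eqAdj_edgeOf j)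
    · exact H.neAdj_grid _ _ (H.neAdj_edgeOf j)
  rcases H.edgeOf_eq_of_memG h with he | he <;> rw [he] at hadj
  · exact hadj
  · exact gridAdjacent_comm.1 hadj

/-- The pair list has no duplicates. [cite: BlaserDorflerIkenmeyer2020, Lemma 29, proof (arXiv, TeX L2278–2281; = CCC 2021 Lemma 8.8)] -/
theorem nodup_pairList (N : ℕ) : (pairList N).Nodup := by
  unfold pairList
  refine List.Nodup.filter _ ?_
  rw [List.nodup_flatMap]
  constructor
  · intro u _
    exact (List.nodup_finRange N).map fun a b h => (Prod.mk.inj h).2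
  · refine (List.nodup_finRange N).pairwise_of_forall_ne fun a _ b _ hab => ?_
    simp only [Function.onFun]
    rw [List.disjoint_left]
    intro p hp hp'
    simp only [List.mem_map, List.mem_finRange, true_and] at hp hp'
    obtain ⟨x, rfl⟩ := hp
    obtain ⟨y, hy⟩ := hp'
    exact hab (Prod.mk.inj hy).1.symm

/-- The equality edge list has no duplicates. [cite: BlaserDorflerIkenmeyer2020, Lemma 29, proof (arXiv, TeX L2278–2281; = CCC 2021 Lemma 8.8)] -/
theorem nodup_eqList : H.eqList.Nodup := (nodup_pairList N).filter _

/-- The inequality edge list has no duplicates. [cite: BlaserDorflerIkenmeyer2020, Lemma 29, proof (arXiv, TeX L2278–2281; = CCC 2021 Lemma 8.8)] -/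
theorem nodup_neList : H.neList.Nodup := (nodup_pairList N).filter _

/-- Distinct gadgets replace distinct edges (no edge carries both labels).
[cite: BlaserDorflerIkenmeyer2020, §8 before Lemma 28 ("every edge can either be an equality or inequality edge") (arXiv, TeX L2078; = CCC 2021 §8)] -/
theorem edgeOf_injective (hs : H.EdgesSimple) : Function.Injective H.edgeOf := by
  rintro (j | j) (j' | j') h
  · simp only [edgeOf] at h
    exact congrArg Sum.inl (Fin.ext ((H.nodup_eqList.getElem_inj_iff).1 h))
  · exfalso
    have h1 := H.eqAdj_edgeOf j
    have h2 := H.neAdj_edgeOf j'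
    rw [← h] at h2
    exact hs _ _ ⟨h1, h2⟩
  · exfalso
    have h1 := H.neAdj_edgeOf j
    have h2 := H.eqAdj_edgeOf j'
    rw [← h] at h2
    exact hs _ _ ⟨h2, h1⟩
  · simp only [edgeOf] at h
    exact congrArg Sum.inr (Fin.ext ((H.nodup_neList.getElem_inj_iff).1 h))

/-- A port meets at most four gadgets (the four grid neighbours).
[cite: BlaserDorflerIkenmeyer2020, Lemma 26, proof ("a degree of `2, 4, 6` or `8`") (arXiv, TeX L1931–1932; = CCC 2021 Lemma 8.5)] -/
theorem incCount_le_four (hs : H.EdgesSimple) (v : Fin N) : H.incCount v ≤ 4 := by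
  classical
  set x := (H.pos v).1
  set y := (H.pos v).2
  let T : Finset (ℕ × ℕ) := {(x + 1, y), (x - 1, y), (x, y + 1), (x, y - 1)}
  have hT : T.card ≤ 4 := by
    refine (Finset.card_insert_le _ _).trans ?_
    refine Nat.succ_le_succ ((Finset.card_insert_le _ _).trans ?_)
    refine Nat.succ_le_succ ((Finset.card_insert_le _ _).trans ?_)
    simp
  unfold incCount
  refine (Finset.card_le_card_of_injOn (fun g => H.pos (H.other g v)) ?_ ?_).trans hT
  · intro g hg
    have hg' : H.MemG g v := by simpa using hg
    have ha := H.gridAdjacent_other hg'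
    have hxy : H.pos v = (x, y) := rfl
    rw [hxy] at ha
    unfold GridAdjacent at ha
    simp only [Finset.coe_insert, Finset.coe_singleton, Set.mem_insert_iff, Set.mem_singleton_iff, T,
      Prod.ext_iff]
    omega
  · intro g hg g' hg' hfg
    have hm : H.MemG g v := by simpa using hg
    have hm' : H.MemG g' v := by simpa using hg'
    have ho : H.other g v = H.other g' v := H.pos_injective hfg
    apply H.edgeOf_injective hs
    have hlt := H.edgeOf_fst_lt_snd g
    have hlt' := H.edgeOf_fst_lt_snd g'
    rcases H.edgeOf_eq_of_memG hm with he | he <;> rcases H.edgeOf_eq_of_memG hm' with he' | he'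
    · rw [he, he', ho]
    · exfalso
      rw [he, ho] at hlt; rw [he'] at hlt'
      exact lt_asymm hlt hlt'
    · exfalso
      rw [he, ho] at hlt; rw [he'] at hlt'
      exact lt_asymm hlt hlt'
    · rw [he, he', ho]

/-- **Every port has degree `8`.** [cite: BlaserDorflerIkenmeyer2020, Lemma 26, proof (arXiv, TeX L1927–1932; = CCC 2021 Lemma 8.5)] -/
theorem degW_port (hiso : H.NoIsolated) (hs : H.EdgesSimple) (v : Fin N) : H.degW (Sum.inl v) = 8 := by
  rw [degW_port_eq, H.sum_share_eq_four v (H.one_le_incCount hiso v) (H.incCount_le_four hs v)]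

/-- **`G₂` is `8`-regular** (as a multigraph). [cite: BlaserDorflerIkenmeyer2020, Lemma 29 ("the `8`-regular grid-like layered graph `G_2`") and Lemma 26, proof (arXiv, TeX L2281, L1927–1932; = CCC 2021 Lemmas 8.8, 8.5)] -/
theorem degW_eq_eight (hiso : H.NoIsolated) (hs : H.EdgesSimple) (w : H.W) : H.degW w = 8 := by
  rcases w with v | ⟨⟨j, i⟩⟩ | ⟨⟨j, i⟩⟩
  · exact H.degW_port hiso hs v
  · exact H.degW_innerEq j i
  · exact H.degW_innerNe j i

/-! ## Size: `|V(G₂)| = O(|V(H)|)` -/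

/-- Handshake: the gadget count is at most `2N` (every port meets at most four gadgets, every
gadget has two ports). [cite: BlaserDorflerIkenmeyer2020, Lemma 29, proof ("`G_2` now has `O(|V(G)|)` many vertices") (arXiv, TeX L2281; = CCC 2021 Lemma 8.8)] -/
theorem numEq_add_numNe_le (hs : H.EdgesSimple) : H.numEq + H.numNe ≤ 2 * N := by
  classical
  have h1 : (∑ v : Fin N, H.incCount v) = 2 * (H.numEq + H.numNe) := by
    unfold incCount
    simp only [Finset.card_filter]
    rw [Finset.sum_comm]
    have hg : ∀ g : H.GIdx, (∑ v : Fin N, if H.MemG g v then 1 else 0) = 2 := fun g => by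
      rw [← Finset.card_filter]
      have : (Finset.univ.filter fun v => H.MemG g v) = {H.lo g, H.hi g} := by
        ext v; simp [MemG]
      rw [this, Finset.card_pair (H.lo_ne_hi g)]
    simp only [hg, Finset.sum_const, Finset.card_univ, smul_eq_mul, Fintype.card_sum, Fintype.card_fin]
    unfold numEq numNe; ring
  have h2 : (∑ v : Fin N, H.incCount v) ≤ ∑ _v : Fin N, 4 :=
    Finset.sum_le_sum fun v _ => H.incCount_le_four hs v
  simp only [Finset.sum_const, Finset.card_univ, Fintype.card_fin, smul_eq_mul] at h2
  omega

/-- **Linear size:** `|V(G₂)| ≤ 13 · |V(H)|`. [cite: BlaserDorflerIkenmeyer2020, Lemma 29, proof ("`G_2` now has `O(|V(G)|)` many vertices") (arXiv, TeX L2281; = CCC 2021 Lemma 8.8)] -/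
theorem card₂_le (hs : H.EdgesSimple) : H.card₂ ≤ 13 * N := by
  have := H.numEq_add_numNe_le hs
  unfold card₂; omega

/-! ## The statements on the flat vertex set `Fin card₂` (closed forms for the code-level map) -/

/-- **The multiplicities of `G₂` on `Fin card₂`.** [cite: BlaserDorflerIkenmeyer2020, Lemma 29, proof (arXiv, TeX L2278–2281; = CCC 2021 Lemma 8.8)] -/
def mult₂ (a b : Fin H.card₂) : ℕ := H.mult (H.wEquiv a) (H.wEquiv b)

/-- **`8`-regularity on `Fin card₂`.** [cite: BlaserDorflerIkenmeyer2020, Lemma 29 ("`8`-regular grid-like layered graph `G_2`") (arXiv, TeX L2281; = CCC 2021 Lemma 8.8)] -/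
theorem sum_mult₂_eq_eight (hiso : H.NoIsolated) (hs : H.EdgesSimple) (a : Fin H.card₂) :
    (∑ b, H.mult₂ a b) = 8 := by
  rw [← H.degW_eq_eight hiso hs (H.wEquiv a)]
  unfold degW mult₂
  exact Fintype.sum_equiv H.wEquiv _ _ fun b => rfl

/-- The multiplicities are symmetric. [cite: BlaserDorflerIkenmeyer2020, Lemma 26, Fig. eqgadgetmult (arXiv; = CCC 2021 Lemma 8.5)] -/
theorem mult_comm (w w' : H.W) : H.mult w w' = H.mult w' w := by
  by_cases h : 0 < H.mult w w' ∨ 0 < H.mult w' w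
  · have key : ∀ w w' : H.W, 0 < H.mult w w' → H.mult w w' = H.mult w' w := by
      intro w w' hpos
      rcases H.exists_attach_of_mult_pos hpos with ⟨j, a, b, rfl, rfl, -⟩ | ⟨j, a, b, rfl, rfl, -⟩
      · rw [mult_attachEq, mult_attachEq]
        unfold multEq; split_ifs
        · exact eqGadgetHMult_symm _ _ a b
        · exact eqGadgetVMult_symm _ _ a b
      · rw [mult_attachNe, mult_attachNe]
        unfold multNe; split_ifs
        · exact neGadgetHMult_symm _ _ a b
        · exact neGadgetVMult_symm _ _ a b
    rcases h with h | h
    · exact key _ _ h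
    · exact (key _ _ h).symm
  · omega

/-- The multigraph has no loops. [cite: BlaserDorflerIkenmeyer2020, Lemma 26, Fig. eqgadgetmult (arXiv; = CCC 2021 Lemma 8.5)] -/
theorem mult_self (w : H.W) : H.mult w w = 0 := by
  by_contra h
  have hpos : 0 < H.mult w w := Nat.pos_of_ne_zero h
  have l7H : ∀ a : Fin 7, (a, a) ∉ eqGadgetH.edges := by decide
  have l7V : ∀ a : Fin 7, (a, a) ∉ eqGadgetV.edges := by decide
  have l8H : ∀ a : Fin 8, (a, a) ∉ neGadgetH.edges := by decide
  have l8V : ∀ a : Fin 8, (a, a) ∉ neGadgetV.edges := by decide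
  rcases H.exists_attach_of_mult_pos hpos with ⟨j, a, b, ha, hb, hab⟩ | ⟨j, a, b, ha, hb, hab⟩
  · have : a = b := by
      have := H.idxEq_attachEq j a; rw [← ha, hb, H.idxEq_attachEq] at this
      exact (Option.some.inj this).symm
    subst this
    have he : (a, a) ∈ H.edgesEq j := by
      rcases (H.multEq_pos_iff j a a).1 hab with he | he <;> exact he
    unfold edgesEq at he
    split_ifs at he
    · exact l7H a he
    · exact l7V a he
  · have : a = b := by
      have := H.idxNe_attachNe j a; rw [← ha, hb, H.idxNe_attachNe] at this
      exact (Option.some.inj this).symm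
    subst this
    have he : (a, a) ∈ H.edgesNe j := by
      rcases (H.multNe_pos_iff j a a).1 hab with he | he <;> exact he
    unfold edgesNe at he
    split_ifs at he
    · exact l8H a he
    · exact l8V a he

/-- **Lemma 29, colouring equivalence on `Fin card₂`:** `G₂` is properly `3`-colourable iff `H` is
relationally `3`-colourable. [cite: BlaserDorflerIkenmeyer2020, Lemma 29, proof (arXiv, TeX L2278–2283; = CCC 2021 Lemma 8.8)] -/
theorem exists_proper_mult₂_iff :
    (∃ c : Fin H.card₂ → Fin 3, ∀ a b, 0 < H.mult₂ a b → c a ≠ c b) ↔ H.IsRelColourable := by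
  rw [← H.exists_isProperW_iff]
  constructor
  · rintro ⟨c, hc⟩
    refine ⟨fun w => c (H.wEquiv.symm w), fun w w' h => hc _ _ ?_⟩
    simpa [mult₂] using h
  · rintro ⟨c, hc⟩
    exact ⟨fun a => c (H.wEquiv a), fun a b h => hc _ _ h⟩

/-! ## The embedding `e : V(G₂) → ℕ × ℕ` (closed form; the parity mirroring rule)

The positions are DEFINED here so that the code-level map can mirror them; the proofs that they make
`G₂` grid-like layered (Def. 24: injective, inter- and intra-layer adjacency, non-crossing, every vertex on
an inter-layer edge) are the geometric half of Lemma 29 and are NOT in this file (see the module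
docstring and `HOME/np/MEMO-t20g10-BDI20-FILE-D-blueprint.md`). -/

/-- Ports sit at `4·e_H(v) + (2, 2)` (scale `4` = the gadgets' port distance; shift `2` keeps the
mirrored bumps inside `ℕ × ℕ`). [cite: BlaserDorflerIkenmeyer2020, Lemma 26, proof ("replacing all edges in a subgraph of a grid yields a grid-like layered graph") (arXiv, TeX L1925–1926; = CCC 2021 Lemma 8.5)] -/
def scalePos (p : ℕ × ℕ) : ℕ × ℕ := (4 * p.1 + 2, 4 * p.2 + 2)

/-- Local positions of `H^=_1` relative to `v₁` (FILE B `eqGadgetH.pos` minus `(1,1)`). [cite: BlaserDorflerIkenmeyer2020, Lemma 26, Fig. eqneqgadget (arXiv, TeX L1825–1844; = CCC 2021 Lemma 8.5)] -/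
def offEqH : Fin 7 → ℕ × ℕ := ![(0,0), (1,0), (1,1), (2,0), (3,0), (3,1), (4,0)]

/-- Local positions of `H^=_2` relative to its bottom vertex. [cite: BlaserDorflerIkenmeyer2020, Lemma 26, Fig. eqneqgadget (arXiv, TeX L1846–1864; = CCC 2021 Lemma 8.5)] -/
def offEqV : Fin 7 → ℕ × ℕ := ![(0,0), (0,1), (1,1), (0,2), (0,3), (1,3), (0,4)]

/-- Local positions of `H^≠_1` relative to `v₁`. [cite: BlaserDorflerIkenmeyer2020, Lemma 26, Fig. eqneqgadget (arXiv, TeX L1866–1886; = CCC 2021 Lemma 8.5)] -/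
def offNeH : Fin 8 → ℕ × ℕ := ![(0,0), (1,0), (1,1), (2,0), (2,1), (3,0), (3,1), (4,0)]

/-- Local positions of `H^≠_2` relative to its bottom vertex. [cite: BlaserDorflerIkenmeyer2020, Lemma 26, Fig. eqneqgadget (arXiv, TeX L1888–1905; = CCC 2021 Lemma 8.5)] -/
def offNeV : Fin 8 → ℕ × ℕ := ![(0,0), (0,1), (1,1), (0,2), (1,2), (0,3), (1,3), (0,4)]

/-- The parity `(x + y) mod 2` of the lower end of a gadget's edge — decides the mirroring.
[cite: BlaserDorflerIkenmeyer2020, Lemma 26, proof (TeX L1925–1926; the unprinted placement rule, registry B47) (arXiv; = CCC 2021 Lemma 8.5)] -/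
def parity (g : H.GIdx) : ℕ := ((H.pos (H.lo g)).1 + (H.pos (H.lo g)).2) % 2

/-- **The parity mirroring placement** of a local offset `o` of gadget `g`: horizontal gadgets keep
their bumps ABOVE the axis at even lower ends and BELOW at odd ones; vertical gadgets keep their bumps
to the LEFT at even lower ends and to the RIGHT at odd ones (as drawn = above / right). This is the
rule under which the replaced graph is injectively embedded (the drawn placement collides at every
vertex with a rightward and an upward edge).
[cite: BlaserDorflerIkenmeyer2020, Lemma 26, proof ("It can be easily checked that replacing all edges in a subgraph of a grid yields a grid-like layered graph" — with this rule; registry B47) (arXiv, TeX L1925–1926; = CCC 2021 Lemma 8.5)] -/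
def place (g : H.GIdx) (o : ℕ × ℕ) : ℕ × ℕ :=
  let B := scalePos (H.pos (H.lo g))
  if H.isHor g then
    (if H.parity g = 0 then (B.1 + o.1, B.2 + o.2) else (B.1 + o.1, B.2 - o.2))
  else
    (if H.parity g = 0 then (B.1 - o.1, B.2 + o.2) else (B.1 + o.1, B.2 + o.2))

/-- **The embedding of `G₂`** on the structured vertices. [cite: BlaserDorflerIkenmeyer2020, Def. 24 and Lemma 26, proof (arXiv, TeX L1665–1678, L1925–1926; = CCC 2021 Def. 8.3, Lemma 8.5)] -/
def posW : H.W → ℕ × ℕ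
  | Sum.inl v => scalePos (H.pos v)
  | Sum.inr (Sum.inl (j, i)) =>
      H.place (Sum.inl j) ((if H.isHor (Sum.inl j) then offEqH else offEqV) ⟨i.1 + 1, by omega⟩)
  | Sum.inr (Sum.inr (j, i)) =>
      H.place (Sum.inr j) ((if H.isHor (Sum.inr j) then offNeH else offNeV) ⟨i.1 + 1, by omega⟩)

/-- **The embedding of `G₂` on `Fin card₂`.** [cite: BlaserDorflerIkenmeyer2020, Def. 24 and Lemma 26, proof (arXiv, TeX L1665–1678, L1925–1926; = CCC 2021 Def. 8.3, Lemma 8.5)] -/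
def pos₂ (a : Fin H.card₂) : ℕ × ℕ := H.posW (H.wEquiv a)

end RelGridGraph

end BDI2020

end Literature.Computability.AlgebraicComplexity
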